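import Mathlib
import Summits.Ventures.HodgeRepro.Tier4.Common.AdelicDefs
import Summits.Ventures.HodgeRepro.Tier4.Common.MixedPlane
import Summits.Ventures.HodgeRepro.Tier4.Common.MixedPlaneKType
import Summits.Ventures.HodgeRepro.Tier4.Common.RowPlane
import Summits.Ventures.HodgeRepro.Tier4.Common.RowTorus
import Summits.Ventures.HodgeRepro.Tier4.Line1.PlaneDefs
import Summits.Ventures.HodgeRepro.Tier4.Line4.LevelCosetCongruence
import Summits.Ventures.HodgeRepro.Tier4.Line4.BlockDetCongruence
import Summits.Ventures.HodgeRepro.Tier4.Line4.OrbitInvariant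
import Summits.Ventures.HodgeRepro.Tier4.Line4.OrbitInvariantBridge
import Summits.Ventures.HodgeRepro.Tier4.Line4.OrbitInvariantFibre
import Summits.Ventures.HodgeRepro.Tier4.Line4.LevelKVacuity

/-!
# Tier4/Line4/LinRegularCoords — `IsLinRegular γ` ⇒ all four block scalars of `γ` are non-zero (C-L4-REGCOORD)

Blind re-derivation cell `pub-hodge-repro`, Tier 4 «prove the step» (README §9–§10), seat t4-L1-p3 (gen 4).
Tree path `lean/Summits/Ventures/HodgeRepro/Tier4/Line4/LinRegularCoords.lean`.

THE LINK (crit-1 Entry 150 (1), L2-p3's (a) of S15168): OrbitInvariantFibre's `hreg` — the four block scalars of a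
rational `γ` in the coordinates `x i j = (m g) (2i) (2j)`, `y i j = (m g) (2i+1) (2j)` are non-zero — follows from
`Line1.IsLinRegular W γ` (no non-scalar intertwiner between the `P`-torus algebra and the `Q`-torus algebra through
`γ`).  MATRIX FORM, no `E′`-scalars: with `M := m g` (`m` the `k`-matrix of `γ`, `g` the transport) the unitarity of
`γ` and the similitude `g B′ gᵀ = λ B` give `M B′ Mᵀ = λ B` with BOTH Gram matrices block-diagonal in the `P`-basis;
in blocks `M = [[A, B₁], [C, D]]`: a vanishing block forces the opposite block to vanish («the cross relation kills
the fourth»: `A = 0` ⇒ `B₁ G′₁ B₁ᵀ = λ G₀`, so `B₁` is invertible, and `B₁ G′₁ Dᵀ = 0` ⇒ `D = 0`; likewise the other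
three), hence `P₀ M = M P₁` (resp. `P₀ M = M P₀`), i.e. `P₀ m = m Q₁` (resp. `m Q₀`) — the intertwiner pair
`(adMat P₀, adMat Q₁)` (resp. `Q₀`) that `IsLinRegular` forbids, since `P₀` is not an `E′`-scalar (`P₀ 0 0 = 1`,
`P₀ 2 2 = 0`).  The block `(i, j)` of `M` commutes with `ω`, so it vanishes iff `x i j = y i j = 0`
(`commute_omegaMatR_iff`).  No printed input.  HC_CM is NOT proved by anyone in this repository.
-/

namespace Summit.Ventures.HodgeRepro.Tier4.Line4

open Summit.Ventures.HodgeRepro.Tier4.Common NumberField Matrix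
open scoped NumberField

noncomputable section

/-! ## Block algebra over a field -/

section Blocks

variable {k : Type} [Field k]

/-- The block relations of `N B′ Nᵀ = λ • B` for block-diagonal `B, B′`. -/
theorem block_relations {A B₁ C D G₀ G₁ G'₀ G'₁ : Matrix (Fin 2) (Fin 2) k} {lam : k}
    (h : fromBlocks A B₁ C D * fromBlocks G'₀ 0 0 G'₁ * (fromBlocks A B₁ C D)ᵀ =
      lam • fromBlocks G₀ 0 0 G₁) :
    A * G'₀ * Aᵀ + B₁ * G'₁ * B₁ᵀ = lam • G₀ ∧ A * G'₀ * Cᵀ + B₁ * G'₁ * Dᵀ = 0 ∧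
      C * G'₀ * Aᵀ + D * G'₁ * B₁ᵀ = 0 ∧ C * G'₀ * Cᵀ + D * G'₁ * Dᵀ = lam • G₁ := by
  rw [fromBlocks_transpose, fromBlocks_multiply, fromBlocks_multiply, fromBlocks_smul] at h
  simp only [Matrix.mul_zero, add_zero, zero_add, smul_zero] at h
  obtain ⟨h1, h2, h3, h4⟩ := fromBlocks_inj.mp h
  exact ⟨h1, h2, h3, h4⟩

/-- `X Y = 0` with `X` invertible forces `Y = 0`. -/
theorem eq_zero_of_mul_eq_zero_of_det_ne_zero {X Y : Matrix (Fin 2) (Fin 2) k} (hX : X.det ≠ 0)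
    (h : X * Y = 0) : Y = 0 := by
  have hu : IsUnit X.det := isUnit_iff_ne_zero.mpr hX
  calc Y = X⁻¹ * (X * Y) := by rw [← Matrix.mul_assoc, Matrix.nonsing_inv_mul X hu, Matrix.one_mul]
    _ = 0 := by rw [h, Matrix.mul_zero]

/-- A block with `B₁ G′ B₁ᵀ = λ • G` (`λ ≠ 0`, `G, G′` non-degenerate) is invertible. -/
theorem det_ne_zero_of_congr {B₁ G' G : Matrix (Fin 2) (Fin 2) k} {lam : k} (hlam : lam ≠ 0)
    (hG : G.det ≠ 0) (h : B₁ * G' * B₁ᵀ = lam • G) : B₁.det ≠ 0 := by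
  intro h0
  have := congrArg Matrix.det h
  rw [Matrix.det_mul, Matrix.det_mul, Matrix.det_transpose, h0, Matrix.det_smul, Fintype.card_fin] at this
  simp only [zero_mul, mul_zero] at this
  exact (mul_ne_zero (pow_ne_zero 2 hlam) hG) this.symm

/-- **The cross relation kills the fourth block**: `A = 0 ⇒ D = 0`. -/
theorem D_eq_zero_of_A_eq_zero {A B₁ C D G₀ G₁ G'₀ G'₁ : Matrix (Fin 2) (Fin 2) k} {lam : k} (hlam : lam ≠ 0)
    (hG₀ : G₀.det ≠ 0) (hG'₁ : G'₁.det ≠ 0)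
    (h : fromBlocks A B₁ C D * fromBlocks G'₀ 0 0 G'₁ * (fromBlocks A B₁ C D)ᵀ = lam • fromBlocks G₀ 0 0 G₁)
    (hA : A = 0) : D = 0 := by
  obtain ⟨h1, h2, -, -⟩ := block_relations h
  rw [hA, Matrix.zero_mul, Matrix.zero_mul, zero_add] at h1 h2
  have hB₁ : B₁.det ≠ 0 := det_ne_zero_of_congr hlam hG₀ h1
  have hXdet : (B₁ * G'₁).det ≠ 0 := by rw [Matrix.det_mul]; exact mul_ne_zero hB₁ hG'₁
  have := eq_zero_of_mul_eq_zero_of_det_ne_zero hXdet h2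
  rw [← Matrix.transpose_zero] at this
  exact Matrix.transpose_injective this

/-- `D = 0 ⇒ A = 0`. -/
theorem A_eq_zero_of_D_eq_zero {A B₁ C D G₀ G₁ G'₀ G'₁ : Matrix (Fin 2) (Fin 2) k} {lam : k} (hlam : lam ≠ 0)
    (hG₁ : G₁.det ≠ 0) (hG'₀ : G'₀.det ≠ 0)
    (h : fromBlocks A B₁ C D * fromBlocks G'₀ 0 0 G'₁ * (fromBlocks A B₁ C D)ᵀ = lam • fromBlocks G₀ 0 0 G₁)
    (hD : D = 0) : A = 0 := by
  obtain ⟨-, -, h3, h4⟩ := block_relations h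
  rw [hD, Matrix.zero_mul, Matrix.zero_mul, add_zero] at h3 h4
  have hC : C.det ≠ 0 := det_ne_zero_of_congr hlam hG₁ h4
  have hXdet : (C * G'₀).det ≠ 0 := by rw [Matrix.det_mul]; exact mul_ne_zero hC hG'₀
  have := eq_zero_of_mul_eq_zero_of_det_ne_zero hXdet h3
  rw [← Matrix.transpose_zero] at this
  exact Matrix.transpose_injective this

/-- `B₁ = 0 ⇒ C = 0`. -/
theorem C_eq_zero_of_B_eq_zero {A B₁ C D G₀ G₁ G'₀ G'₁ : Matrix (Fin 2) (Fin 2) k} {lam : k} (hlam : lam ≠ 0)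
    (hG₀ : G₀.det ≠ 0) (hG'₀ : G'₀.det ≠ 0)
    (h : fromBlocks A B₁ C D * fromBlocks G'₀ 0 0 G'₁ * (fromBlocks A B₁ C D)ᵀ = lam • fromBlocks G₀ 0 0 G₁)
    (hB : B₁ = 0) : C = 0 := by
  obtain ⟨h1, h2, -, -⟩ := block_relations h
  rw [hB, Matrix.zero_mul, Matrix.zero_mul, add_zero] at h1 h2
  have hA : A.det ≠ 0 := det_ne_zero_of_congr hlam hG₀ h1
  have hXdet : (A * G'₀).det ≠ 0 := by rw [Matrix.det_mul]; exact mul_ne_zero hA hG'₀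
  have := eq_zero_of_mul_eq_zero_of_det_ne_zero hXdet h2
  rw [← Matrix.transpose_zero] at this
  exact Matrix.transpose_injective this

/-- `C = 0 ⇒ B₁ = 0`. -/
theorem B_eq_zero_of_C_eq_zero {A B₁ C D G₀ G₁ G'₀ G'₁ : Matrix (Fin 2) (Fin 2) k} {lam : k} (hlam : lam ≠ 0)
    (hG₁ : G₁.det ≠ 0) (hG'₁ : G'₁.det ≠ 0)
    (h : fromBlocks A B₁ C D * fromBlocks G'₀ 0 0 G'₁ * (fromBlocks A B₁ C D)ᵀ = lam • fromBlocks G₀ 0 0 G₁)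
    (hC : C = 0) : B₁ = 0 := by
  obtain ⟨-, -, h3, h4⟩ := block_relations h
  rw [hC, Matrix.zero_mul, Matrix.zero_mul, zero_add] at h3 h4
  have hD : D.det ≠ 0 := det_ne_zero_of_congr hlam hG₁ h4
  have hXdet : (D * G'₁).det ≠ 0 := by rw [Matrix.det_mul]; exact mul_ne_zero hD hG'₁
  have := eq_zero_of_mul_eq_zero_of_det_ne_zero hXdet h3
  rw [← Matrix.transpose_zero] at this
  exact Matrix.transpose_injective this

/-- The intertwiner `P₀ N = N P₁` when the diagonal blocks vanish. -/
theorem P0_mul_eq_mul_P1 {A B₁ C D : Matrix (Fin 2) (Fin 2) k} (hA : A = 0) (hD : D = 0) :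
    fromBlocks (1 : Matrix (Fin 2) (Fin 2) k) 0 0 0 * fromBlocks A B₁ C D =
      fromBlocks A B₁ C D * fromBlocks 0 0 0 (1 : Matrix (Fin 2) (Fin 2) k) := by
  rw [fromBlocks_multiply, fromBlocks_multiply, hA, hD]
  simp only [Matrix.one_mul, Matrix.mul_one, Matrix.zero_mul, Matrix.mul_zero, add_zero, zero_add]

/-- The intertwiner `P₀ N = N P₀` when the off-diagonal blocks vanish. -/
theorem P0_mul_eq_mul_P0 {A B₁ C D : Matrix (Fin 2) (Fin 2) k} (hB : B₁ = 0) (hC : C = 0) :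
    fromBlocks (1 : Matrix (Fin 2) (Fin 2) k) 0 0 0 * fromBlocks A B₁ C D =
      fromBlocks A B₁ C D * fromBlocks (1 : Matrix (Fin 2) (Fin 2) k) 0 0 0 := by
  rw [fromBlocks_multiply, fromBlocks_multiply, hB, hC]
  simp only [Matrix.one_mul, Matrix.mul_one, Matrix.zero_mul, Matrix.mul_zero, add_zero]

end Blocks

/-! ## The plane: `IsLinRegular ⇒` the four block scalars are non-zero -/

section Plane

variable {k : Type} [Field k] [NumberField k] (q : QuadData k) (a b ε a' b' ε' : k)
  (g g' : Matrix (Fin 4) (Fin 4) k)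

omit [NumberField k] in
/-- The Gram matrix of a row plane is `re4R` of the block-diagonal Gram blocks. -/
theorem ofLinesRow_B_eq_re4R :
    (PlaneData.ofLinesRow q a b ε).B = re4R (fromBlocks (lineGramRow q a) 0 0 (ε • lineGramRow q b)) := rfl

omit [NumberField k] in
/-- `re4R.symm` commutes with transposition. -/
theorem re4R_symm_transpose (M : Matrix (Fin 4) (Fin 4) k) :
    (re4R (R := k)).symm Mᵀ = ((re4R (R := k)).symm M)ᵀ := by
  simp only [re4R, Matrix.symm_reindexAlgEquiv, Matrix.coe_reindexAlgEquiv, Matrix.transpose_reindex]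

omit [NumberField k] in
/-- **The block relation of a rational point**: `M B′ Mᵀ = λ • B` for `M = m g`, transported to `2×2` blocks. -/
theorem block_relation_of_unitary (lam : k)
    (hiso : g * (PlaneData.ofLinesRow q a' b' ε').B * gᵀ = lam • (PlaneData.ofLinesRow q a b ε).B)
    {m : Matrix (Fin 4) (Fin 4) k}
    (hmB : m * (PlaneData.ofLinesRow q a b ε).B * mᵀ = (PlaneData.ofLinesRow q a b ε).B) :
    (re4R (R := k)).symm (m * g) * fromBlocks (lineGramRow q a') 0 0 (ε' • lineGramRow q b') *
        ((re4R (R := k)).symm (m * g))ᵀ =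
      lam • fromBlocks (lineGramRow q a) 0 0 (ε • lineGramRow q b) := by
  have hM : (m * g) * (PlaneData.ofLinesRow q a' b' ε').B * (m * g)ᵀ = lam • (PlaneData.ofLinesRow q a b ε).B := by
    rw [Matrix.transpose_mul]
    calc m * g * (PlaneData.ofLinesRow q a' b' ε').B * (gᵀ * mᵀ)
        = m * (g * (PlaneData.ofLinesRow q a' b' ε').B * gᵀ) * mᵀ := by simp only [Matrix.mul_assoc]
      _ = m * (lam • (PlaneData.ofLinesRow q a b ε).B) * mᵀ := by rw [hiso]
      _ = lam • (m * (PlaneData.ofLinesRow q a b ε).B * mᵀ) := by rw [Matrix.mul_smul, Matrix.smul_mul]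
      _ = lam • (PlaneData.ofLinesRow q a b ε).B := by rw [hmB]
  have h := congrArg (re4R (R := k)).symm hM
  rw [map_mul, map_mul, map_smul, re4R_symm_transpose, ofLinesRow_B_eq_re4R q a' b' ε',
    ofLinesRow_B_eq_re4R q a b ε, AlgEquiv.symm_apply_apply, AlgEquiv.symm_apply_apply] at h
  exact h

omit [NumberField k] in
/-- Each block of a matrix commuting with `Ω = ω ⊕ ω` commutes with `ω`. -/
theorem blocks_comm_omega {M : Matrix (Fin 4) (Fin 4) k}
    (hMΩ : M * (PlaneData.ofLinesRow q a b ε).Ω = (PlaneData.ofLinesRow q a b ε).Ω * M) :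
    Matrix.toBlocks₁₁ ((re4R (R := k)).symm M) * omegaMatR q.t q.n =
        omegaMatR q.t q.n * Matrix.toBlocks₁₁ ((re4R (R := k)).symm M) ∧
      Matrix.toBlocks₁₂ ((re4R (R := k)).symm M) * omegaMatR q.t q.n =
        omegaMatR q.t q.n * Matrix.toBlocks₁₂ ((re4R (R := k)).symm M) ∧
      Matrix.toBlocks₂₁ ((re4R (R := k)).symm M) * omegaMatR q.t q.n =
        omegaMatR q.t q.n * Matrix.toBlocks₂₁ ((re4R (R := k)).symm M) ∧
      Matrix.toBlocks₂₂ ((re4R (R := k)).symm M) * omegaMatR q.t q.n =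
        omegaMatR q.t q.n * Matrix.toBlocks₂₂ ((re4R (R := k)).symm M) := by
  have h := congrArg (re4R (R := k)).symm hMΩ
  rw [map_mul, map_mul, ofLinesRow_Ω_eq_blockDiag4R] at h
  unfold blockDiag4R at h
  rw [AlgEquiv.symm_apply_apply] at h
  set N := (re4R (R := k)).symm M with hN
  rw [← Matrix.fromBlocks_toBlocks N, fromBlocks_multiply, fromBlocks_multiply] at h
  simp only [Matrix.mul_zero, Matrix.zero_mul, add_zero, zero_add] at h
  obtain ⟨h1, h2, h3, h4⟩ := fromBlocks_inj.mp h
  exact ⟨h1, h2, h3, h4⟩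

omit [NumberField k] in
/-- A `2×2` block commuting with `ω` whose `(0,0)` and `(1,0)` entries vanish is `0`. -/
theorem block_eq_zero_of_entries {X : Matrix (Fin 2) (Fin 2) k} (hX : X * omegaMatR q.t q.n = omegaMatR q.t q.n * X)
    (h00 : X 0 0 = 0) (h10 : X 1 0 = 0) : X = 0 := by
  rw [commute_omegaMatR_iff] at hX
  rw [hX, h00, h10, zero_smul, zero_smul, add_zero]

omit [NumberField k] in
/-- The Gram blocks are non-degenerate (`a ≠ 0`, `t² ≠ 4n`). -/
theorem det_lineGramRow_ne_zero (hq : q.t ^ 2 - 4 * q.n ≠ 0) {a : k} (ha : a ≠ 0) :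
    (lineGramRow q a).det ≠ 0 := by
  rw [det_lineGramRow]
  refine mul_ne_zero (pow_ne_zero 2 ha) ?_
  intro h
  apply hq
  linear_combination -h

omit [NumberField k] in
/-- The scaled Gram block `ε • lineGramRow q b` is non-degenerate (`ε ≠ 0`, `b ≠ 0`, `t² ≠ 4n`). -/
theorem det_smul_lineGramRow_ne_zero (hq : q.t ^ 2 - 4 * q.n ≠ 0) {ε b : k} (hε : ε ≠ 0) (hb : b ≠ 0) :
    (ε • lineGramRow q b).det ≠ 0 := by
  rw [Matrix.det_smul, Fintype.card_fin]
  exact mul_ne_zero (pow_ne_zero 2 hε) (det_lineGramRow_ne_zero q hq hb)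

omit [NumberField k] in
/-- The projectors of a plane are orthogonal: `P 0 * P 1 = 0` and `P 1 * P 0 = 0`. -/
theorem P_zero_mul_P_one (W : PlaneData k) : W.P 0 * W.P 1 = 0 ∧ W.P 1 * W.P 0 = 0 := by
  have h1 : W.P 1 = 1 - W.P 0 := by rw [← W.P_sum]; abel
  constructor
  · rw [h1, Matrix.mul_sub, Matrix.mul_one, W.P_idem 0, sub_self]
  · rw [h1, Matrix.sub_mul, Matrix.one_mul, W.P_idem 0, sub_self]

omit [NumberField k] in
/-- The transported projectors are orthogonal: `Q 0 * Q 1 = 0` and `Q 1 * Q 0 = 0`. -/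
theorem Q_zero_mul_Q_one (W : PlaneData k) : W.Q 0 * W.Q 1 = 0 ∧ W.Q 1 * W.Q 0 = 0 := by
  have h1 : W.Q 1 = 1 - W.Q 0 := by rw [← W.Q_sum]; abel
  constructor
  · rw [h1, Matrix.mul_sub, Matrix.mul_one, W.Q_idem 0, sub_self]
  · rw [h1, Matrix.sub_mul, Matrix.one_mul, W.Q_idem 0, sub_self]

/-- `adMat (P 0)` commutes with every `adMat (P i)`. -/
theorem adMat_P_zero_comm (W : PlaneData k) :
    ∀ i : Fin 2, adMat k (W.P 0) * adMat k (W.P i) = adMat k (W.P i) * adMat k (W.P 0)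
  | 0 => rfl
  | 1 => by rw [← adMat_mul, ← adMat_mul, (P_zero_mul_P_one W).1, (P_zero_mul_P_one W).2]

/-- `adMat (Q j)` commutes with every `adMat (Q i)`. -/
theorem adMat_Q_comm (W : PlaneData k) :
    ∀ j i : Fin 2, adMat k (W.Q j) * adMat k (W.Q i) = adMat k (W.Q i) * adMat k (W.Q j)
  | 0, 0 => rfl
  | 0, 1 => by rw [← adMat_mul, ← adMat_mul, (Q_zero_mul_Q_one W).1, (Q_zero_mul_Q_one W).2]
  | 1, 0 => by rw [← adMat_mul, ← adMat_mul, (Q_zero_mul_Q_one W).1, (Q_zero_mul_Q_one W).2]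
  | 1, 1 => rfl

/-- `adMat (P 0)` is not an `E′`-scalar: the entries `(0,0) = 1` and `(2,2) = 0` differ. -/
theorem adMat_P_zero_ofLinesRow_ne_scalar (x y : Ad k) :
    adMat k ((PlaneData.ofLinesRow q a b ε).P 0) ≠
      x • (1 : M4 k) + y • adMat k (PlaneData.ofLinesRow q a b ε).Ω := by
  intro h
  have hP : (PlaneData.ofLinesRow q a b ε).P 0 = !![1, 0, 0, 0; 0, 1, 0, 0; 0, 0, 0, 0; 0, 0, 0, 0] := by
    rw [ofLinesRow_P_zero_eq, blockDiag4R_one_zero_eq]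
  have hΩ : (PlaneData.ofLinesRow q a b ε).Ω = !![0, -q.n, 0, 0; 1, q.t, 0, 0; 0, 0, 0, -q.n; 0, 0, 1, q.t] := by
    rw [ofLinesRow_Ω_eq_blockDiag4R, blockDiag4R_omegaMatR_eq]
  have h00 := congrFun (congrFun h 0) 0
  have h22 := congrFun (congrFun h 2) 2
  simp [adMat, hP, hΩ] at h00 h22
  -- h00 : 1 = x, h22 : 0 = x
  have : (1 : Ad k) = 0 := by rw [h00, ← h22]
  have h1 := algebraMap_Ad_injective (k := k) (show algebraMap k (Ad k) 1 = algebraMap k (Ad k) 0 by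
    rw [map_one, map_zero]; exact this)
  exact one_ne_zero h1

/-- **`IsLinRegular` forbids the intertwiner `P₀ m = m Q_j`**: on a plane `W` with the row plane's `Ω, P` and the
transported `Q_j = g P_j g'`, a rational `γ` (matrix `m`) with `P₀ (m g) = (m g) P_j` is not `IsLinRegular`. -/
theorem false_of_intertwine (hgg' : g * g' = 1) (W : PlaneData k) (hWΩ : W.Ω = (PlaneData.ofLinesRow q a b ε).Ω)
    (hWP : ∀ i, W.P i = (PlaneData.ofLinesRow q a b ε).P i)
    (hWQ : ∀ j, W.Q j = g * (PlaneData.ofLinesRow q a b ε).P j * g')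
    {γ : rationalPoints W} (hreg : Line1.IsLinRegular W γ) {m : Matrix (Fin 4) (Fin 4) k}
    (hm : GA.mat W (γ : GA W) = m.map (algebraMap k (Ad k))) (j : Fin 2)
    (hPM : (PlaneData.ofLinesRow q a b ε).P 0 * (m * g) = (m * g) * (PlaneData.ofLinesRow q a b ε).P j) :
    False := by
  have hPm : (PlaneData.ofLinesRow q a b ε).P 0 * m = m * W.Q j := by
    rw [hWQ j]
    calc (PlaneData.ofLinesRow q a b ε).P 0 * m
        = (PlaneData.ofLinesRow q a b ε).P 0 * (m * g) * g' := by
          rw [Matrix.mul_assoc, Matrix.mul_assoc, hgg', Matrix.mul_one]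
      _ = m * g * (PlaneData.ofLinesRow q a b ε).P j * g' := by rw [hPM]
      _ = m * (g * (PlaneData.ofLinesRow q a b ε).P j * g') := by simp only [Matrix.mul_assoc]
  have hY1 : adMat k ((PlaneData.ofLinesRow q a b ε).P 0) * adMat k W.Ω =
      adMat k W.Ω * adMat k ((PlaneData.ofLinesRow q a b ε).P 0) := by
    rw [hWΩ, ← adMat_mul, ← adMat_mul, (PlaneData.ofLinesRow q a b ε).P_comm 0]
  have hY2 : ∀ i, adMat k ((PlaneData.ofLinesRow q a b ε).P 0) * adMat k (W.P i) =
      adMat k (W.P i) * adMat k ((PlaneData.ofLinesRow q a b ε).P 0) := by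
    intro i
    rw [hWP i]
    exact adMat_P_zero_comm _ i
  have hY'1 : adMat k (W.Q j) * adMat k W.Ω = adMat k W.Ω * adMat k (W.Q j) := by
    rw [← adMat_mul, ← adMat_mul, W.Q_comm j]
  have hY'2 : ∀ i, adMat k (W.Q j) * adMat k (W.Q i) = adMat k (W.Q i) * adMat k (W.Q j) := adMat_Q_comm W j
  have hYγ : adMat k ((PlaneData.ofLinesRow q a b ε).P 0) * GA.mat W (γ : GA W) =
      GA.mat W (γ : GA W) * adMat k (W.Q j) := by
    rw [hm]
    show adMat k ((PlaneData.ofLinesRow q a b ε).P 0) * adMat k m = adMat k m * adMat k (W.Q j)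
    rw [← adMat_mul, ← adMat_mul, hPm]
  obtain ⟨x, y, hx, -⟩ := hreg (adMat k ((PlaneData.ofLinesRow q a b ε).P 0)) (adMat k (W.Q j)) hY1 hY2 hY'1 hY'2 hYγ
  rw [hWΩ] at hx
  exact adMat_P_zero_ofLinesRow_ne_scalar q a b ε x y hx

/-- **`IsLinRegular γ ⇒ the four block scalars of `γ` are non-zero`** (the coordinate `hreg` of OrbitInvariantFibre),
on the transported row plane with the similitude `g B′ gᵀ = λ B`. -/
theorem hreg_of_isLinRegular (hgg' : g * g' = 1) (hg'g : g' * g = 1)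
    (hgΩ : g * (PlaneData.ofLinesRow q a b ε).Ω = (PlaneData.ofLinesRow q a b ε).Ω * g)
    (hq : q.t ^ 2 - 4 * q.n ≠ 0) (ha : a ≠ 0) (hb : b ≠ 0) (hε : ε ≠ 0)
    (ha' : a' ≠ 0) (hb' : b' ≠ 0) (hε' : ε' ≠ 0) (lam : k) (hlam : lam ≠ 0)
    (hiso : g * (PlaneData.ofLinesRow q a' b' ε').B * gᵀ = lam • (PlaneData.ofLinesRow q a b ε).B)
    {γ : rationalPoints ((PlaneData.ofLinesRow q a b ε).withTransportedTorus g g' hgg' hg'g hgΩ)}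
    (hreg : Line1.IsLinRegular _ γ) {m : Matrix (Fin 4) (Fin 4) k}
    (hm : GA.mat ((PlaneData.ofLinesRow q a b ε).withTransportedTorus g g' hgg' hg'g hgΩ)
      (γ : GA ((PlaneData.ofLinesRow q a b ε).withTransportedTorus g g' hgg' hg'g hgΩ)) =
      m.map (algebraMap k (Ad k))) :
    ∀ i j : Fin 2, ¬ ((m * g) (![0, 2] i) (![0, 2] j) = 0 ∧ (m * g) (![1, 3] i) (![0, 2] j) = 0) := by
  obtain ⟨hmΩ, hmB⟩ := rational_mat_props _ hm.symm
  have hmΩ' : m * (PlaneData.ofLinesRow q a b ε).Ω = (PlaneData.ofLinesRow q a b ε).Ω * m := hmΩ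
  have hmB' : m * (PlaneData.ofLinesRow q a b ε).B * mᵀ = (PlaneData.ofLinesRow q a b ε).B := hmB
  have hMΩ : (m * g) * (PlaneData.ofLinesRow q a b ε).Ω = (PlaneData.ofLinesRow q a b ε).Ω * (m * g) := by
    rw [Matrix.mul_assoc, hgΩ, ← Matrix.mul_assoc, hmΩ', Matrix.mul_assoc]
  have hrel := block_relation_of_unitary q a b ε a' b' ε' g lam hiso hmB'
  obtain ⟨hc11, hc12, hc21, hc22⟩ := blocks_comm_omega q a b ε hMΩ
  set N := (re4R (R := k)).symm (m * g) with hNdef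
  have hN : fromBlocks (Matrix.toBlocks₁₁ N) (Matrix.toBlocks₁₂ N) (Matrix.toBlocks₂₁ N) (Matrix.toBlocks₂₂ N) = N :=
    Matrix.fromBlocks_toBlocks N
  rw [← hN] at hrel
  have hG₀ := det_lineGramRow_ne_zero q hq ha
  have hG₁ := det_smul_lineGramRow_ne_zero q hq hε hb
  have hG'₀ := det_lineGramRow_ne_zero q hq ha'
  have hG'₁ := det_smul_lineGramRow_ne_zero q hq hε' hb'
  -- the intertwiner contradiction, for `P₀ m = m Q_j`
  have hP0 : (PlaneData.ofLinesRow q a b ε).P 0 = re4R (fromBlocks (1 : Matrix (Fin 2) (Fin 2) k) 0 0 0) := rfl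
  have hP1 : (PlaneData.ofLinesRow q a b ε).P 1 = re4R (fromBlocks 0 0 0 (1 : Matrix (Fin 2) (Fin 2) k)) := rfl
  have contra : ∀ j : Fin 2, (PlaneData.ofLinesRow q a b ε).P 0 * (m * g) = (m * g) * (PlaneData.ofLinesRow q a b ε).P j →
      False := fun j hPM =>
    false_of_intertwine q a b ε g g' hgg' ((PlaneData.ofLinesRow q a b ε).withTransportedTorus g g' hgg' hg'g hgΩ)
      rfl (fun _ => rfl) (fun _ => rfl) hreg hm j hPM
  intro i j hzero
  fin_cases i <;> fin_cases j
  · -- block (0,0) = 0 ⇒ block (1,1) = 0 ⇒ P₀ M = M P₁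
    have hA : Matrix.toBlocks₁₁ N = 0 := block_eq_zero_of_entries q hc11 hzero.1 hzero.2
    have hD := D_eq_zero_of_A_eq_zero hlam hG₀ hG'₁ hrel hA
    apply contra 1
    have h := congrArg (re4R (R := k)) (P0_mul_eq_mul_P1 (B₁ := Matrix.toBlocks₁₂ N) (C := Matrix.toBlocks₂₁ N) hA hD)
    rw [map_mul, map_mul, hN, AlgEquiv.apply_symm_apply] at h
    rw [hP0, hP1]
    exact h
  · -- block (0,1) = 0 ⇒ block (1,0) = 0 ⇒ P₀ M = M P₀
    have hB : Matrix.toBlocks₁₂ N = 0 := block_eq_zero_of_entries q hc12 hzero.1 hzero.2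
    have hC := C_eq_zero_of_B_eq_zero hlam hG₀ hG'₀ hrel hB
    apply contra 0
    have h := congrArg (re4R (R := k)) (P0_mul_eq_mul_P0 (A := Matrix.toBlocks₁₁ N) (D := Matrix.toBlocks₂₂ N) hB hC)
    rw [map_mul, map_mul, hN, AlgEquiv.apply_symm_apply] at h
    rw [hP0]
    exact h
  · -- block (1,0) = 0 ⇒ block (0,1) = 0
    have hC : Matrix.toBlocks₂₁ N = 0 := block_eq_zero_of_entries q hc21 hzero.1 hzero.2
    have hB := B_eq_zero_of_C_eq_zero hlam hG₁ hG'₁ hrel hC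
    apply contra 0
    have h := congrArg (re4R (R := k)) (P0_mul_eq_mul_P0 (A := Matrix.toBlocks₁₁ N) (D := Matrix.toBlocks₂₂ N) hB hC)
    rw [map_mul, map_mul, hN, AlgEquiv.apply_symm_apply] at h
    rw [hP0]
    exact h
  · -- block (1,1) = 0 ⇒ block (0,0) = 0
    have hD : Matrix.toBlocks₂₂ N = 0 := block_eq_zero_of_entries q hc22 hzero.1 hzero.2
    have hA := A_eq_zero_of_D_eq_zero hlam hG₁ hG'₀ hrel hD
    apply contra 1
    have h := congrArg (re4R (R := k)) (P0_mul_eq_mul_P1 (B₁ := Matrix.toBlocks₁₂ N) (C := Matrix.toBlocks₂₁ N) hA hD)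
    rw [map_mul, map_mul, hN, AlgEquiv.apply_symm_apply] at h
    rw [hP0, hP1]
    exact h

end Plane

end

end Summit.Ventures.HodgeRepro.Tier4.Line4
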